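import Mathlib.Analysis.SpecialFunctions.Pow.Asymptotics
import Literature.Probability.Percolation.SupercriticalIsoperimetricProfile
import Literature.Probability.Percolation.AnchoredIsoperimetricProfileLocality
import HarnessLib

/-!
# The anchored isoperimetric profile above `p_c`: `liminf_n n φ̂_n(p) > 0` from Pete's isoperimetry

Topic `Literature/Probability/Percolation`. Theorems only. The POSITIVITY half, in order of
magnitude, of

* [CerfDembin2020] R. Cerf, B. Dembin, Electron. Commun. Probab. 25 (2020), Thm. 1.1 =
  [Dembin2020] B. Dembin, ALEA 17 (2020), Thm. 1.1 (`n φ_n(p) → φ(p) > 0` a.s. on `{0 ∈ C_∞}`,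
  `p > p_c`, `d ≥ 2`; the tree's named fact `CerfDembin2020_thm11`),

namely **`liminf_n n φ̂_n(p) > 0` a.s. on `{0 ∈ C_∞}` for `p > p_c(ℤ^d)`** — the statement that
"`φ_n n` is of order `1`" which Dembin 2020, §1 recalls from Benjamini–Mossel (2003),
Mathieu–Remy (2004), Rau, Berger–Biskup–Hoffman–Kozma (2008) and Pete (2008) — derived here from
the in-box isoperimetry of the supercritical cluster in the form of the tree's named fact
`Pete2008_cor13` (G. Pete, Electron. Commun. Probab. 13 (2008), Cor. 1.3: a.s. eventually in
`m`, every open-connected `S ⊆ C_∞ ∩ [-m,m]^d` with `|S| ≥ c₃ (log m)^{d/(d-1)}` has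
`|∂_{C_∞} S| ≥ α |S|^{1-1/d}`), taken as a hypothesis `(h : Pete2008_cor13)`.

The deduction (`mul_card_le_of_isoperimetry`): let `C(0)` be infinite and `H` a valid subgraph of
`C(0)` (`IsValidSubgraph`: `0 ∈ H`, every `x ∈ H` joined to `0` by an open path inside `H`) with
`|H| ≤ n^d`. Then `H` is open-connected, `H ⊆ C(0) = C_∞` (every vertex of `H` percolates) and
`H ⊆ [-n^d, n^d]^d` (`IsValidSubgraph.mem_box`). If `|H| ≥ c₃ (log n^d)^{d/(d-1)}`, Pete's
inequality at level `m = n^d` gives `|∂_ω H| ≥ α |H|^{1-1/d} ≥ α |H| / n` because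
`|H|^{1/d} ≤ n`; otherwise `|H| < c₃ (d log n)^{d/(d-1)} ≤ n` for `n` large
(`eventually_mul_log_rpow_le`), while `|∂_ω H| ≥ 1` because `H` is a finite part of the infinite
cluster (`IsValidSubgraph.one_le_openEdgeBoundaryCard_of_infinite`). In both cases
`min(α,1) |H| ≤ n |∂_ω H|`. Hence (`ae_mul_card_le_of_pete`) for `p > p_c` there is a
DETERMINISTIC `c = c(p,d) > 0` such that a.s. on `{C(0) infinite}`, for all large `n` and all
valid `H` with `|H| ≤ n^d`, `c |H| ≤ n |∂_ω H|`; equivalently `c ≤ n φ̂_n` eventually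
(`ae_eventually_le_mul_anchoredProfile_of_pete`). This is the conclusion
`CerfDembin2020_thm11.ae_exists_mul_card_le` of `AnchoredIsoperimetricProfileCutset.lean` (there
derived from Theorem 1.1 itself), i.e. the `p > p_c` case of the route item
`PercThresholdOne.SamePAnchoredIsoperimetry`, now resting on Pete's Corollary 1.3 instead of on
Dembin's theorem. It is NOT a discharge of `CerfDembin2020_thm11` (the existence of the limit and
its identification `φ(p)` are Dembin's large-deviation theorems).

## References

* R. Cerf, B. Dembin, Electron. Commun. Probab. 25 (2020), Thm. 1.1 [CerfDembin2020].
* B. Dembin, ALEA Lat. Am. J. Probab. Math. Stat. 17 (2020), Thm. 1.1 and §1 [Dembin2020].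
* G. Pete, Electron. Commun. Probab. 13 (2008) 377–392, Cor. 1.3 [Pete2008].
-/

noncomputable section

namespace Literature.Probability.Percolation

open LatticeModels Asymptotics
open _root_.MeasureTheory _root_.Filter
open scoped _root_.Topology

variable {d : ℕ}

/-! ## Valid subgraphs are open-connected pieces of `C_∞` inside a box -/

/-- In a valid subgraph every two vertices are joined by an open path inside it.
[cite: CerfDembin2020, §1 (valid subgraph of C(0))] -/
theorem IsValidSubgraph.mem_openConnIn {ω : BondConfig (Site d)} {H : Finset (Site d)}
    (hH : IsValidSubgraph d ω H) {x y : Site d} (hx : x ∈ H) (hy : y ∈ H) :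
    ω ∈ openConnIn (↑H : Set (Site d)) x y := by
  obtain ⟨h0, hx', h1⟩ := hH.2 x hx
  obtain ⟨_, hy', h2⟩ := hH.2 y hy
  exact ⟨hx', hy', h1.symm.trans h2⟩

/-- If `C(0)` is infinite, every vertex of a valid subgraph lies in an infinite open cluster
(namely `C(0)`). [cite: CerfDembin2020, §1 (valid subgraph of C(0), {0 ∈ C_∞})] -/
theorem IsValidSubgraph.mem_percolatesAt {ω : BondConfig (Site d)} {H : Finset (Site d)}
    (hH : IsValidSubgraph d ω H) (hinf : (openCluster ω 0).Infinite) {x : Site d} (hx : x ∈ H) :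
    ω ∈ percolatesAt x := by
  have hx0 : x ∈ openCluster ω 0 := hH.subset_openCluster (Finset.mem_coe.2 hx)
  have heq : openCluster ω x = openCluster ω 0 := by
    ext y
    exact ⟨fun hy => SimpleGraph.Reachable.trans hx0 hy,
      fun hy => SimpleGraph.Reachable.trans hx0.symm hy⟩
  show (openCluster ω x).Infinite
  rw [heq]
  exact hinf

/-- A valid subgraph with `|H| ≤ m` lies in the box `[-m, m]^d` (indeed in `[-(|H|-1), |H|-1]^d`,
`IsValidSubgraph.mem_box`). [cite: CerfDembin2020, §1 (valid subgraph of C(0))] -/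
theorem IsValidSubgraph.subset_box {ω : BondConfig (Site d)} (hω : ω ⊆ (zdGraph d).edgeSet)
    {H : Finset (Site d)} (hH : IsValidSubgraph d ω H) {m : ℕ} (hm : H.card ≤ m) :
    H ⊆ box d m := by
  intro x hx
  have h := hH.mem_box hω hx
  rw [LatticeModels.mem_box] at h ⊢
  intro i
  have h1 := h i
  have h2 : ((H.card - 1 : ℕ) : ℤ) ≤ m := by
    have : H.card - 1 ≤ m := (Nat.sub_le _ _).trans hm
    exact_mod_cast this
  constructor <;> omega

/-! ## The deterministic deduction -/

/-- `|H|^{1/d} ≤ n` when `|H| ≤ n^d`. [folklore] -/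
theorem rpow_inv_le_of_card_le_pow {H : Finset (Site d)} {n : ℕ} (hd : d ≠ 0)
    (hcard : H.card ≤ n ^ d) : (H.card : ℝ) ^ (1 / (d : ℝ)) ≤ n := by
  have h1 : (H.card : ℝ) ≤ (n : ℝ) ^ d := by exact_mod_cast hcard
  calc (H.card : ℝ) ^ (1 / (d : ℝ)) ≤ ((n : ℝ) ^ d) ^ (1 / (d : ℝ)) :=
        Real.rpow_le_rpow (Nat.cast_nonneg _) h1 (by positivity)
    _ = n := by rw [one_div, Real.pow_rpow_inv_natCast (Nat.cast_nonneg _) hd]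

/-- **The deterministic core.** Let `ω ⊆ E(ℤ^d)` with `C(0)` infinite, and suppose Pete's
isoperimetric inequality holds at level `n^d`: every open-connected `S ⊆ [-n^d, n^d]^d` all of
whose vertices percolate and with `|S| ≥ c₃ (log n^d)^{d/(d-1)}` has `α |S|^{1-1/d} ≤ |∂_ω S|`.
If moreover `c₃ (log n^d)^{d/(d-1)} ≤ n`, then every valid `H` with `|H| ≤ n^d` satisfies
`min(α, 1) |H| ≤ n |∂_ω H|` (large `H`: Pete and `|H|^{1/d} ≤ n`; small `H`: `|∂_ω H| ≥ 1`).
[cite: Pete2008, Cor. 1.3] [cite: Dembin2020, §1 (φ_n n is of order 1)] -/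
theorem mul_card_le_of_isoperimetry (hd : d ≠ 0) {ω : BondConfig (Site d)}
    (hω : ω ⊆ (zdGraph d).edgeSet) (hinf : (openCluster ω 0).Infinite) {c₃ α : ℝ} {n : ℕ}
    (hP : ∀ S : Finset (Site d), S ⊆ box d (n ^ d) →
      (∀ x ∈ S, ω ∈ percolatesAt x) →
      (∀ x ∈ S, ∀ y ∈ S, ω ∈ openConnIn (↑S : Set (Site d)) x y) →
      c₃ * Real.log ((n ^ d : ℕ) : ℝ) ^ ((d : ℝ) / ((d : ℝ) - 1)) ≤ (S.card : ℝ) →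
      α * (S.card : ℝ) ^ (1 - 1 / (d : ℝ)) ≤ (openEdgeBoundaryCard d ω S : ℝ))
    (hn : c₃ * Real.log ((n ^ d : ℕ) : ℝ) ^ ((d : ℝ) / ((d : ℝ) - 1)) ≤ n)
    {H : Finset (Site d)} (hH : IsValidSubgraph d ω H) (hcard : H.card ≤ n ^ d) :
    min α 1 * H.card ≤ (n : ℝ) * (openEdgeBoundaryCard d ω H : ℝ) := by
  have hHpos : (0 : ℝ) < H.card := by exact_mod_cast hH.card_pos
  by_cases hbig : c₃ * Real.log ((n ^ d : ℕ) : ℝ) ^ ((d : ℝ) / ((d : ℝ) - 1)) ≤ (H.card : ℝ)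
  · -- large `H`: Pete's inequality applies
    have hiso : α * (H.card : ℝ) ^ (1 - 1 / (d : ℝ)) ≤ (openEdgeBoundaryCard d ω H : ℝ) :=
      hP H (hH.subset_box hω hcard) (fun x hx => hH.mem_percolatesAt hinf hx)
        (fun x hx y hy => hH.mem_openConnIn hx hy) hbig
    have h1 : (H.card : ℝ) ^ (1 / (d : ℝ)) ≤ n := rpow_inv_le_of_card_le_pow hd hcard
    have h2 : (H.card : ℝ) = (H.card : ℝ) ^ (1 - 1 / (d : ℝ)) * (H.card : ℝ) ^ (1 / (d : ℝ)) := by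
      rw [← Real.rpow_add hHpos, sub_add_cancel, Real.rpow_one]
    have h3 : 0 ≤ (H.card : ℝ) ^ (1 - 1 / (d : ℝ)) := Real.rpow_nonneg hHpos.le _
    calc min α 1 * H.card ≤ α * H.card := mul_le_mul_of_nonneg_right (min_le_left _ _) hHpos.le
      _ = (α * (H.card : ℝ) ^ (1 - 1 / (d : ℝ))) * (H.card : ℝ) ^ (1 / (d : ℝ)) := by
          conv_lhs => rw [h2]
          ring
      _ ≤ (openEdgeBoundaryCard d ω H : ℝ) * n :=
          mul_le_mul hiso h1 (Real.rpow_nonneg hHpos.le _) (Nat.cast_nonneg _)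
      _ = (n : ℝ) * (openEdgeBoundaryCard d ω H : ℝ) := mul_comm _ _
  · -- small `H`: at least one open boundary edge
    have hbig := not_le.1 hbig
    have h1 : (1 : ℝ) ≤ (openEdgeBoundaryCard d ω H : ℝ) := by
      exact_mod_cast hH.one_le_openEdgeBoundaryCard_of_infinite hω hinf
    calc min α 1 * H.card ≤ 1 * H.card := mul_le_mul_of_nonneg_right (min_le_right _ _) hHpos.le
      _ ≤ n := by rw [one_mul]; exact hbig.le.trans hn
      _ ≤ (n : ℝ) * (openEdgeBoundaryCard d ω H : ℝ) :=
          le_mul_of_one_le_right (Nat.cast_nonneg _) h1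

/-- The logarithmic threshold is eventually below `n`: `c (log n^d)^κ ≤ n` for all large `n`
(`(log y)^κ = o(y^{1/d})` along `y = n^d`). [folklore] -/
theorem eventually_mul_log_rpow_le (hd : d ≠ 0) (c κ : ℝ) :
    ∀ᶠ n : ℕ in atTop, c * Real.log ((n ^ d : ℕ) : ℝ) ^ κ ≤ n := by
  have hlog0 : ∀ n : ℕ, 0 ≤ Real.log ((n ^ d : ℕ) : ℝ) ^ κ := fun n =>
    Real.rpow_nonneg (Real.log_natCast_nonneg _) _
  rcases le_or_gt c 0 with hc | hc
  · exact Eventually.of_forall fun n =>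
      (mul_nonpos_of_nonpos_of_nonneg hc (hlog0 n)).trans (Nat.cast_nonneg _)
  · have hds : (0 : ℝ) < (d : ℝ)⁻¹ := inv_pos.2 (by exact_mod_cast Nat.pos_of_ne_zero hd)
    have hlo : (fun y : ℝ => Real.log y ^ κ) =o[atTop] fun y => y ^ (d : ℝ)⁻¹ :=
      isLittleO_log_rpow_rpow_atTop κ hds
    have htend : Tendsto (fun n : ℕ => ((n ^ d : ℕ) : ℝ)) atTop atTop := by
      have h1 : Tendsto (fun n : ℕ => n ^ d) atTop atTop := tendsto_pow_atTop hd
      exact tendsto_natCast_atTop_atTop.comp h1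
    have hcomp := hlo.comp_tendsto htend
    have hbound := hcomp.def (inv_pos.2 hc)
    filter_upwards [hbound] with n hn
    simp only [Function.comp] at hn
    rw [Real.norm_of_nonneg (hlog0 n), Real.norm_of_nonneg (Real.rpow_nonneg (Nat.cast_nonneg _) _),
      Nat.cast_pow, Real.pow_rpow_inv_natCast (Nat.cast_nonneg _) hd] at hn
    rw [Nat.cast_pow]
    calc c * Real.log ((n : ℝ) ^ d) ^ κ ≤ c * (c⁻¹ * n) := mul_le_mul_of_nonneg_left hn hc.le
      _ = n := by rw [← mul_assoc, mul_inv_cancel₀ hc.ne', one_mul]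

/-! ## The almost sure statements -/

/-- **`liminf_n n φ̂_n(p) > 0` above `p_c`, competitor form, from Pete's isoperimetry.** Assume
`Pete2008_cor13`. For `d ≥ 2` and `p > p_c(ℤ^d)` there is `c = c(p, d) > 0` such that
`P_p`-a.s. on `{C(0) infinite}` there is `N` with `c |H| ≤ n |∂_ω H|` for all `n ≥ N` and all valid
subgraphs `H` of `C(0)` with `|H| ≤ n^d`. This is the conclusion
`CerfDembin2020_thm11.ae_exists_mul_card_le` (the order-of-magnitude positivity half of
Cerf–Dembin 2020 Thm. 1.1 = Dembin 2020 Thm. 1.1, "`φ_n n` is of order 1", Dembin 2020 §1), here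
with a deterministic constant. [cite: Pete2008, Cor. 1.3] [cite: Dembin2020, Thm. 1.1 and §1] -/
theorem ae_mul_card_le_of_pete (h : Pete2008_cor13) (hd : 2 ≤ d) (p : unitInterval)
    (hp : criticalProb (zdGraph d) (0 : Site d) < (p : ℝ)) :
    ∃ c : ℝ, 0 < c ∧ ∀ᵐ ω ∂(bondPercolation (zdGraph d) p), (openCluster ω 0).Infinite →
      ∃ N : ℕ, ∀ n : ℕ, N ≤ n → ∀ H : Finset (Site d),
        IsValidSubgraph d ω H → H.card ≤ n ^ d →
          c * H.card ≤ (n : ℝ) * (openEdgeBoundaryCard d ω H : ℝ) := by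
  have hd0 : d ≠ 0 := by omega
  obtain ⟨c₃, α, -, hα, hae⟩ := h d hd p hp
  refine ⟨min α 1, lt_min hα one_pos, ?_⟩
  obtain ⟨N₁, hN₁⟩ := eventually_atTop.1
    (eventually_mul_log_rpow_le hd0 c₃ ((d : ℝ) / ((d : ℝ) - 1)))
  have hsub : ∀ᵐ ω ∂(bondPercolation (zdGraph d) p), ω ⊆ (zdGraph d).edgeSet :=
    ProbabilityTheory.setBernoulli_ae_subset
  filter_upwards [hae, hsub] with ω hω hωE hinf
  obtain ⟨N₀, hN₀⟩ := hω
  refine ⟨max N₁ (N₀ + 1), fun n hn H hH hcard => ?_⟩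
  have hn1 : N₁ ≤ n := le_of_max_le_left hn
  have hn0 : N₀ < n ^ d :=
    lt_of_lt_of_le (by have := le_of_max_le_right hn; omega) (Nat.le_self_pow hd0 n)
  exact mul_card_le_of_isoperimetry hd0 hωE hinf (hN₀ (n ^ d) hn0) (hN₁ n hn1) hH hcard

/-- **`liminf_n n φ̂_n(p) ≥ c(p,d) > 0` a.s. on `{C(0) infinite}` for `p > p_c`, profile form**
(from `Pete2008_cor13`): there is `c > 0` with, `P_p`-a.s. on `{C(0) infinite}`, `c ≤ n φ̂_n(p)`
for all large `n`. [cite: Pete2008, Cor. 1.3] [cite: Dembin2020, Thm. 1.1 and §1 (φ_n n is of order 1)] -/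
theorem ae_eventually_le_mul_anchoredProfile_of_pete (h : Pete2008_cor13) (hd : 2 ≤ d)
    (p : unitInterval) (hp : criticalProb (zdGraph d) (0 : Site d) < (p : ℝ)) :
    ∃ c : ℝ, 0 < c ∧ ∀ᵐ ω ∂(bondPercolation (zdGraph d) p), (openCluster ω 0).Infinite →
      ∀ᶠ n : ℕ in atTop, c ≤ (n : ℝ) * anchoredProfile d n ω := by
  obtain ⟨c, hc, hae⟩ := ae_mul_card_le_of_pete h hd p hp
  refine ⟨c, hc, ?_⟩
  filter_upwards [hae] with ω hω hinf
  obtain ⟨N, hN⟩ := hω hinf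
  filter_upwards [eventually_ge_atTop N, eventually_ge_atTop 1] with n hn hn1
  have hnpos : (0 : ℝ) < n := by exact_mod_cast hn1
  have hle : c / n ≤ anchoredProfile d n ω := by
    refine le_anchoredProfile_of_forall hn1 fun H hH hcard => ?_
    have hHpos : (0 : ℝ) < H.card := by exact_mod_cast hH.card_pos
    rw [div_le_div_iff₀ hnpos hHpos, mul_comm _ (n : ℝ)]
    exact hN n hn H hH hcard
  calc c = (n : ℝ) * (c / n) := by field_simp
    _ ≤ (n : ℝ) * anchoredProfile d n ω := mul_le_mul_of_nonneg_left hle hnpos.le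

/-- **The route form** (shape of `PercThresholdOne.SamePAnchoredIsoperimetry`, for `p > p_c(ℤ^d)`):
assuming `Pete2008_cor13`, `P_p`-a.s. on `{C(0) infinite}` there are `c > 0` and `N` with
`c |K| ≤ n |∂° K|` for all `n ≥ N` and all valid `K` with `|K| ≤ n^d`, where
`|∂° K| = ((edgeBoundary K) ∩ ω).ncard` — literally the conclusion of
`CerfDembin2020_thm11.ae_exists_mul_card_le`. [cite: Pete2008, Cor. 1.3] [cite: CerfDembin2020, Thm. 1.1 (consequence: liminf n φ̂_n > 0)] -/
theorem ae_exists_mul_card_le_of_pete (h : Pete2008_cor13) (hd : 2 ≤ d) (p : unitInterval)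
    (hp : criticalProb (zdGraph d) (0 : Site d) < (p : ℝ)) :
    ∀ᵐ ω ∂(bondPercolation (zdGraph d) p), (openCluster ω 0).Infinite →
      ∃ c : ℝ, 0 < c ∧ ∃ N : ℕ, ∀ n : ℕ, N ≤ n → ∀ K : Finset (Site d),
        IsValidSubgraph d ω K → K.card ≤ n ^ d →
          c * K.card ≤ (n : ℝ) * (openEdgeBoundaryCard d ω K : ℝ) := by
  obtain ⟨c, hc, hae⟩ := ae_mul_card_le_of_pete h hd p hp
  filter_upwards [hae] with ω hω hinf
  exact ⟨c, hc, hω hinf⟩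

end Literature.Probability.Percolation

end
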